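import Summits.RiemannHypothesis.RiemannHypothesis.Theorems.AsymptoticCriticalLine.Negative.BandForms

/-!
# `AsymptoticCriticalLine` (crux `stmt-RiemannHypothesis-2063`, route `RuelleBand`):
# ladder calculus — the power-sum rungs between #5 and #4, kill propagation, what does NOT reach
# the crux, and tightness of the line (negative-side support, cycle 2)

Support file of the crux disprover (cdisprove seat refuter-cdisprove-stmt-RiemannHypothesis-2063-g2-0),
companion of `BandForms.lean` (whose `bandSet Z ε = {s | Z s = 0 ∧ 0 < Re s ∧ Re s < 1 ∧ ε ≤ |Re s − 1/2|}`
it uses). Everything is proved `sorry`-free: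

* `acl_iff_strict`; QUANTIFIER SWAP `cofinite_iff_exists_forall`: the crux is `∀ ε ∃ T`
  (`acl_iff_height`), rung #5 `CofiniteCriticalLine` is literally `∃ T ∀ ε`;
* the POWER-SUM ("Schatten-`k`") RUNGS `∑_{ρ off-line} |Re ρ − 1/2|^k < ∞`, written as bounded
  finite sums over `offLineSet Z`: exponent `0` IS rung #5 (`powerSum_bounded_zero_iff`), the rungs
  are monotone in `k` (`powerSum_bounded_mono`), #5 implies all of them
  (`powerSum_bounded_of_finite`) and each implies the band shape / the crux
  (`band_finite_of_powerSum_bounded`, `acl_of_powerSum_bounded`);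
* KILL PROPAGATION: a second band kills every power-sum rung, rung #5, thesis X and Mathlib's
  `RiemannHypothesis` (`not_riemannHypothesis_of_not_acl`);
* WHAT DOES NOT REACH, by abstract zero sets: all rungs `k ≥ 1` together do not give #5
  (`not_forall_powerSum_imp_finite`, zero set `1/2 + 2^{−(n+2)} + in`), and all HEIGHT sums
  `∑_{band} (1 + |Im ρ|)^{−θ} < ∞`, `θ > 0`, together do not give the band shape
  (`not_forall_heightSum_imp_band`, zero set `3/4 + i 2^n`) — summability in the height, which is
  all that zero-density theorems give, never yields finiteness;
* TIGHTNESS OF THE LINE (Hardy 1914, tree): the crux centred at any `σ₀ ≠ 1/2` is false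
  (`not_band_at_other_line`).
-/

noncomputable section

namespace Summit.RiemannHypothesis.RiemannHypothesis.Theorems.AsymptoticCriticalLine.Negative

open Complex Set
open Summit.RiemannHypothesis.RiemannHypothesis.Theses.RuelleBand
  (AsymptoticCriticalLine CofiniteCriticalLine ExactFirstBand)

/-! ## 1. Strict form; the quantifier swap is exactly the next rung -/

/-- Strict-inequality form of the crux (band sets are antitone in the level). [folklore] -/
theorem acl_iff_strict :
    AsymptoticCriticalLine ↔
      ∀ ε : ℝ, 0 < ε →
        {s : ℂ | riemannZeta s = 0 ∧ 0 < s.re ∧ s.re < 1 ∧ ε < |s.re - 1 / 2|}.Finite := by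
  rw [acl_iff_bandSet]
  refine ⟨fun h ε hε => (h ε hε).subset fun s ⟨hz, h0, h1, hε'⟩ => ⟨hz, h0, h1, hε'.le⟩,
    fun h ε hε => (h (ε / 2) (by positivity)).subset fun s ⟨hz, h0, h1, hε'⟩ => ⟨hz, h0, h1, ?_⟩⟩
  linarith

/-- QUANTIFIER SWAP = THE NEXT RUNG. The crux reads `∀ ε > 0, ∃ T, (zeros above height T are
ε-close to the line)` (`acl_iff_height`); with the quantifiers swapped, `∃ T, ∀ ε > 0, …`, it is
exactly rung #5 `CofiniteCriticalLine` ("RH above some height"). [folklore] -/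
theorem cofinite_iff_exists_forall :
    CofiniteCriticalLine ↔
      ∃ T : ℝ, ∀ ε : ℝ, 0 < ε → ∀ s : ℂ, riemannZeta s = 0 → 0 < s.re → s.re < 1 →
        T < |s.im| → |s.re - 1 / 2| < ε := by
  constructor
  · intro h
    have h' : Set.Finite {s : ℂ | riemannZeta s = 0 ∧ 0 < s.re ∧ s.re < 1 ∧ s.re ≠ 1 / 2} := h
    obtain ⟨T, hT⟩ := (h'.image fun s : ℂ => |s.im|).bddAbove
    refine ⟨T, fun ε hε s hz h0 h1 hT' => ?_⟩
    have hre : s.re = 1 / 2 := by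
      by_contra hne
      exact (lt_irrefl T) (hT'.trans_le (hT ⟨s, ⟨hz, h0, h1, hne⟩, rfl⟩))
    rw [hre, sub_self, abs_zero]
    exact hε
  · rintro ⟨T, hT⟩
    refine (((isCompact_Icc (a := (0 : ℝ)) (b := 1)).reProdIm
      (isCompact_Icc (a := -T) (b := T))).inter_riemannZetaZeros_finite).subset ?_
    rintro s ⟨hz, h0, h1, hne⟩
    have him : |s.im| ≤ T := by
      by_contra hlt
      have hpos : 0 < |s.re - 1 / 2| := abs_pos.2 (sub_ne_zero.2 hne)
      exact (lt_irrefl _) (hT _ hpos s hz h0 h1 (not_le.1 hlt))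
    exact ⟨Complex.mem_reProdIm.2 ⟨⟨h0.le, h1.le⟩, abs_le.1 him⟩, hz⟩

/-! ## 2. The power-sum ("Schatten") rungs between #5 and #4

The rung of exponent `k` for `Z` is `∑_{ρ off-line} |Re ρ − 1/2|^k < ∞`, written elementarily as
"the sums over finite sets of off-line zeros are bounded":
`∃ C, ∀ F : Finset ℂ, ↑F ⊆ offLineSet Z → ∑ s ∈ F, |s.re − 1/2| ^ k ≤ C`. For `Z = ζ`, `k = 1, 2`
these are the trace-class / Hilbert–Schmidt "Gram defect" rungs of the crux-ideate card
schatten-defect-weyl-majorant (in the diagonal model of support `AsymptoticToRealisation`,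
`T t₀ − U = diag(e^{it₀γ}(e^{t₀(β−1/2)} − 1))` is Schatten-`k` iff the rung holds). -/

/-- Off-line zeros of `Z` in the open strip (rung #5's set-builder with `Z` for `ζ`). [folklore] -/
def offLineSet (Z : ℂ → ℂ) : Set ℂ :=
  {s : ℂ | Z s = 0 ∧ 0 < s.re ∧ s.re < 1 ∧ s.re ≠ 1 / 2}

/-- Rung #5 is the finiteness of `offLineSet riemannZeta`. [folklore] -/
theorem cofinite_iff_offLineSet : CofiniteCriticalLine ↔ (offLineSet riemannZeta).Finite := Iff.rfl

/-- Every positive-level band consists of off-line zeros. [folklore] -/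
theorem bandSet_subset_offLineSet (Z : ℂ → ℂ) {ε : ℝ} (hε : 0 < ε) :
    bandSet Z ε ⊆ offLineSet Z := by
  rintro s ⟨hz, h0, h1, hε'⟩
  refine ⟨hz, h0, h1, fun h => ?_⟩
  rw [h, sub_self, abs_zero] at hε'
  exact (lt_irrefl (0 : ℝ)) (hε.trans_le hε')

/-- Exponent `0`: the rung IS rung #5 (bounded cardinality of the finite subsets). [folklore] -/
theorem powerSum_bounded_zero_iff (Z : ℂ → ℂ) :
    (∃ C : ℝ, ∀ F : Finset ℂ, (↑F : Set ℂ) ⊆ offLineSet Z → ∑ s ∈ F, |s.re - 1 / 2| ^ 0 ≤ C) ↔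
      (offLineSet Z).Finite := by
  constructor
  · rintro ⟨C, hC⟩
    by_contra hinf
    obtain ⟨F, hF, hcard⟩ := Set.Infinite.exists_subset_card_eq hinf (⌈C⌉₊ + 1)
    have h := hC F hF
    simp only [pow_zero, Finset.sum_const, nsmul_eq_mul, mul_one, hcard] at h
    push_cast at h
    linarith [Nat.le_ceil C]
  · intro h
    refine ⟨h.toFinset.card, fun F hF => ?_⟩
    simp only [pow_zero, Finset.sum_const, nsmul_eq_mul, mul_one]
    exact_mod_cast Finset.card_le_card fun s hs => h.mem_toFinset.2 (hF hs)

/-- The rungs are monotone in the exponent (`|Re ρ − 1/2| ≤ 1/2 ≤ 1` in the strip): rung `k`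
implies rung `l` for `k ≤ l` — a ladder DESCENDING from #5 (`k = 0`) towards #4 (`k → ∞`).
[folklore] -/
theorem powerSum_bounded_mono (Z : ℂ → ℂ) {k l : ℕ} (hkl : k ≤ l) :
    (∃ C : ℝ, ∀ F : Finset ℂ, (↑F : Set ℂ) ⊆ offLineSet Z → ∑ s ∈ F, |s.re - 1 / 2| ^ k ≤ C) →
      ∃ C : ℝ, ∀ F : Finset ℂ, (↑F : Set ℂ) ⊆ offLineSet Z → ∑ s ∈ F, |s.re - 1 / 2| ^ l ≤ C := by
  rintro ⟨C, hC⟩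
  refine ⟨C, fun F hF => le_trans (Finset.sum_le_sum fun s hs => ?_) (hC F hF)⟩
  obtain ⟨_, h0, h1, _⟩ := hF hs
  exact pow_le_pow_of_le_one (abs_nonneg _) (by rw [abs_le]; constructor <;> linarith) hkl

/-- Rung #5 (finiteness of the off-line set) implies every power-sum rung. [folklore] -/
theorem powerSum_bounded_of_finite (Z : ℂ → ℂ) (h : (offLineSet Z).Finite) (k : ℕ) :
    ∃ C : ℝ, ∀ F : Finset ℂ, (↑F : Set ℂ) ⊆ offLineSet Z → ∑ s ∈ F, |s.re - 1 / 2| ^ k ≤ C :=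
  powerSum_bounded_mono Z (Nat.zero_le k) ((powerSum_bounded_zero_iff Z).2 h)

/-- Every power-sum rung implies the band shape (#4): an infinite band of level `ε` would carry
unbounded sums `≥ n ε^k`. [folklore] -/
theorem band_finite_of_powerSum_bounded (Z : ℂ → ℂ) {k : ℕ}
    (h : ∃ C : ℝ, ∀ F : Finset ℂ, (↑F : Set ℂ) ⊆ offLineSet Z → ∑ s ∈ F, |s.re - 1 / 2| ^ k ≤ C) :
    ∀ ε : ℝ, 0 < ε → (bandSet Z ε).Finite := by
  obtain ⟨C, hC⟩ := h
  intro ε hε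
  by_contra hinf
  have hεk : 0 < ε ^ k := pow_pos hε k
  obtain ⟨n, hn⟩ := exists_nat_gt (C / ε ^ k)
  obtain ⟨F, hF, hcard⟩ := Set.Infinite.exists_subset_card_eq hinf n
  have hle := hC F (hF.trans (bandSet_subset_offLineSet Z hε))
  have hge : (n : ℝ) * ε ^ k ≤ ∑ s ∈ F, |s.re - 1 / 2| ^ k :=
    calc (n : ℝ) * ε ^ k = ∑ _s ∈ F, ε ^ k := by rw [Finset.sum_const, nsmul_eq_mul, hcard]
      _ ≤ ∑ s ∈ F, |s.re - 1 / 2| ^ k :=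
          Finset.sum_le_sum fun s hs => pow_le_pow_left₀ hε.le (hF hs).2.2.2 k
  have hlt : C < (n : ℝ) * ε ^ k := (div_lt_iff₀ hεk).1 hn
  linarith

/-- For `ζ`: power-sum rung `k` ⇒ the crux … [folklore] -/
theorem acl_of_powerSum_bounded {k : ℕ}
    (h : ∃ C : ℝ, ∀ F : Finset ℂ, (↑F : Set ℂ) ⊆ offLineSet riemannZeta →
      ∑ s ∈ F, |s.re - 1 / 2| ^ k ≤ C) :
    AsymptoticCriticalLine :=
  acl_iff_bandSet.2 (band_finite_of_powerSum_bounded riemannZeta h)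

/-- … and rung #5 ⇒ every power-sum rung. [folklore] -/
theorem powerSum_bounded_of_cofinite (h : CofiniteCriticalLine) (k : ℕ) :
    ∃ C : ℝ, ∀ F : Finset ℂ, (↑F : Set ℂ) ⊆ offLineSet riemannZeta →
      ∑ s ∈ F, |s.re - 1 / 2| ^ k ≤ C :=
  powerSum_bounded_of_finite riemannZeta h k

/-! ## 3. Kill propagation: what a second band would take down with it -/

/-- A kill of the crux kills every power-sum rung … [folklore] -/
theorem not_powerSum_bounded_of_not_acl (h : ¬ AsymptoticCriticalLine) (k : ℕ) :
    ¬ ∃ C : ℝ, ∀ F : Finset ℂ, (↑F : Set ℂ) ⊆ offLineSet riemannZeta →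
      ∑ s ∈ F, |s.re - 1 / 2| ^ k ≤ C :=
  fun hk => h (acl_of_powerSum_bounded hk)

/-- … rung #5 … [folklore] -/
theorem not_cofinite_of_not_acl (h : ¬ AsymptoticCriticalLine) : ¬ CofiniteCriticalLine :=
  fun hc => h (acl_of_powerSum_bounded (powerSum_bounded_of_cofinite hc 0))

/-- … thesis X (via `ζ(σ) ≠ 0` on `(0,1)`, tree `ZetaRealAxis`) … [folklore] -/
theorem not_exactFirstBand_of_not_acl (h : ¬ AsymptoticCriticalLine) : ¬ ExactFirstBand := by
  intro hX
  refine not_cofinite_of_not_acl h (Set.finite_empty.subset ?_)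
  rintro s ⟨hz, h0, h1, hne⟩
  rcases hX s hz h0 h1 with h' | him
  · exact hne h'
  · exact Literature.NumberTheory.LFunctions.riemannZeta_ne_zero_of_im_eq_zero_of_pos_of_lt_one
      him h0 h1 hz

/-- … and Mathlib's `RiemannHypothesis`: a kill of the crux is a disproof of RH. [folklore] -/
theorem not_riemannHypothesis_of_not_acl (h : ¬ AsymptoticCriticalLine) : ¬ RiemannHypothesis := by
  intro hRH
  refine h (acl_iff_bandSet.2 fun ε hε => ?_)
  rw [bandSet_eq_empty_of_riemannHypothesis hRH hε]
  exact Set.finite_empty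

/-! ## 4. What does NOT reach the next rung / the crux (abstract zero sets) -/

/-- The function vanishing exactly on `S` (an abstract "zeta" with prescribed zero set). [folklore] -/
def zeroSetFn (S : Set ℂ) : ℂ → ℂ :=
  Sᶜ.indicator fun _ => 1

/-- [folklore] -/
theorem zeroSetFn_eq_zero_iff (S : Set ℂ) (s : ℂ) : zeroSetFn S s = 0 ↔ s ∈ S := by
  unfold zeroSetFn
  rw [Set.indicator_apply_eq_zero]
  simp only [Set.mem_compl_iff, one_ne_zero, imp_false, not_not]

/-- The abstract zero set `S₁ = {1/2 + 2^{−(n+2)} + i n : n ∈ ℕ}`: off the line, converging to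
it, with `∑ |Re − 1/2| = ∑ 2^{−(n+2)} < ∞`. [folklore] -/
def slowPt (n : ℕ) : ℂ :=
  (((1 : ℝ) / 2 + (1 / 2) ^ (n + 2) : ℝ) : ℂ) + (n : ℂ) * I

/-- [folklore] -/
theorem slowPt_re (n : ℕ) : (slowPt n).re = 1 / 2 + (1 / 2) ^ (n + 2) := by
  simp only [slowPt, add_re, ofReal_re, mul_re, natCast_re, natCast_im, I_re, I_im, mul_zero,
    zero_mul, sub_zero, add_zero]

/-- [folklore] -/
theorem slowPt_im (n : ℕ) : (slowPt n).im = n := by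
  simp only [slowPt, add_im, ofReal_im, mul_im, natCast_re, natCast_im, I_re, I_im, mul_one,
    mul_zero, add_zero, zero_add]

/-- [folklore] -/
theorem slowPt_injective : Function.Injective slowPt := by
  intro a b hab
  have h := congrArg Complex.im hab
  rw [slowPt_im, slowPt_im] at h
  exact_mod_cast h

/-- [folklore] -/
theorem offLineSet_zeroSetFn_range_slowPt :
    offLineSet (zeroSetFn (Set.range slowPt)) = Set.range slowPt := by
  ext s
  simp only [offLineSet, Set.mem_setOf_eq, zeroSetFn_eq_zero_iff]
  constructor
  · exact fun h => h.1
  · rintro ⟨n, rfl⟩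
    have hp : (0 : ℝ) < (1 / 2) ^ (n + 2) := by positivity
    have hp' : ((1 : ℝ) / 2) ^ (n + 2) ≤ 1 / 4 := by
      calc ((1 : ℝ) / 2) ^ (n + 2) ≤ (1 / 2) ^ 2 :=
            pow_le_pow_of_le_one (by norm_num) (by norm_num) (by omega)
        _ = 1 / 4 := by norm_num
    refine ⟨⟨n, rfl⟩, ?_, ?_, ?_⟩ <;> rw [slowPt_re]
    · linarith
    · linarith
    · exact ne_of_gt (by linarith)

/-- ALL POWER-SUM RUNGS `k ≥ 1` TOGETHER DO NOT GIVE RUNG #5 (abstractly): the zero set `S₁`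
has `∑ |Re ρ − 1/2|^k ≤ ∑ 2^{−n} ≤ 2` for every `k ≥ 1`, yet infinitely many off-line points
(quantitative sharpening of `not_abstract_asymptotic_imp_cofinite` in
`Theorems/CofiniteCriticalLine/Negative/AbstractModels.lean`). So a Schatten-class Gram defect,
of any exponent, is by itself no route to #5 / FIN. [folklore] -/
theorem not_forall_powerSum_imp_finite :
    ¬ ∀ Z : ℂ → ℂ,
      (∀ k : ℕ, 1 ≤ k → ∃ C : ℝ, ∀ F : Finset ℂ, (↑F : Set ℂ) ⊆ offLineSet Z →
        ∑ s ∈ F, |s.re - 1 / 2| ^ k ≤ C) → (offLineSet Z).Finite := by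
  classical
  intro h
  have hrungs : ∀ k : ℕ, 1 ≤ k → ∃ C : ℝ, ∀ F : Finset ℂ,
      (↑F : Set ℂ) ⊆ offLineSet (zeroSetFn (Set.range slowPt)) →
        ∑ s ∈ F, |s.re - 1 / 2| ^ k ≤ C := by
    intro k hk
    refine ⟨2, fun F hF => ?_⟩
    rw [offLineSet_zeroSetFn_range_slowPt] at hF
    obtain ⟨P, -, rfl⟩ := Finset.subset_set_image_iff.1
      (show (↑F : Set ℂ) ⊆ slowPt '' Set.univ by rwa [Set.image_univ])
    rw [Finset.sum_image fun a _ b _ hab => slowPt_injective hab]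
    have hterm : ∀ n : ℕ, |(slowPt n).re - 1 / 2| ^ k ≤ ((1 : ℝ) / 2) ^ n := by
      intro n
      rw [slowPt_re, add_sub_cancel_left, abs_of_pos (by positivity)]
      calc (((1 : ℝ) / 2) ^ (n + 2)) ^ k ≤ (((1 : ℝ) / 2) ^ (n + 2)) ^ 1 :=
            pow_le_pow_of_le_one (by positivity) (pow_le_one₀ (by norm_num) (by norm_num)) hk
        _ = ((1 : ℝ) / 2) ^ (n + 2) := pow_one _
        _ ≤ ((1 : ℝ) / 2) ^ n := pow_le_pow_of_le_one (by norm_num) (by norm_num) (by omega)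
    calc ∑ n ∈ P, |(slowPt n).re - 1 / 2| ^ k ≤ ∑ n ∈ P, ((1 : ℝ) / 2) ^ n :=
          Finset.sum_le_sum fun n _ => hterm n
      _ ≤ ∑' n : ℕ, ((1 : ℝ) / 2) ^ n :=
          summable_geometric_two.sum_le_tsum P fun n _ => by positivity
      _ = 2 := tsum_geometric_two
  have hfin := h _ hrungs
  rw [offLineSet_zeroSetFn_range_slowPt] at hfin
  exact Set.infinite_range_of_injective slowPt_injective hfin

/-- The abstract zero set `S₂ = {3/4 + i 2^n : n ∈ ℕ}`: a full second band of exponentially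
sparse height. [folklore] -/
def sparsePt (n : ℕ) : ℂ :=
  (((3 : ℝ) / 4 : ℝ) : ℂ) + (((2 : ℝ) ^ n : ℝ) : ℂ) * I

/-- [folklore] -/
theorem sparsePt_re (n : ℕ) : (sparsePt n).re = 3 / 4 := by
  simp only [sparsePt, add_re, ofReal_re, mul_re, ofReal_im, I_re, I_im, mul_zero, mul_one,
    sub_self, add_zero]

/-- [folklore] -/
theorem sparsePt_im (n : ℕ) : (sparsePt n).im = (2 : ℝ) ^ n := by
  simp only [sparsePt, add_im, ofReal_im, mul_im, ofReal_re, I_re, I_im, mul_one, mul_zero,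
    add_zero, zero_add]

/-- [folklore] -/
theorem sparsePt_injective : Function.Injective sparsePt := by
  intro a b hab
  have h := congrArg Complex.im hab
  rw [sparsePt_im, sparsePt_im] at h
  exact Nat.pow_right_injective (le_refl 2) (by exact_mod_cast h)

/-- Every band of `zeroSetFn S₂` lies in `S₂`. [folklore] -/
theorem bandSet_zeroSetFn_range_sparsePt_subset (ε : ℝ) :
    bandSet (zeroSetFn (Set.range sparsePt)) ε ⊆ Set.range sparsePt :=
  fun _ hs => (zeroSetFn_eq_zero_iff _ _).1 hs.1

/-- ALL HEIGHT-SUM RUNGS `θ > 0` TOGETHER DO NOT GIVE THE BAND SHAPE (abstractly): for `S₂` every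
height sum `∑_{band} (1 + |Im ρ|)^{−θ} ≤ ∑ 2^{−nθ} = (1 − 2^{−θ})⁻¹` is bounded, at every level,
yet the level-`1/4` band is infinite. Summability over heights at any rate — all that zero-DENSITY
theorems provide (for `ζ` every exponent `θ > 1 − 4ε/(3 − 2ε)` at level `ε` is a theorem by
partial summation from Ingham's density estimate, tree `zeroDensity_ingham_holds`) — never yields
finiteness: the "θ-ladder" is disconnected from its endpoint `θ = 0`, the crux (the formal core of
barrier `LindelofBacklund` at this crux). [folklore] -/
theorem not_forall_heightSum_imp_band :
    ¬ ∀ Z : ℂ → ℂ,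
      (∀ ε : ℝ, 0 < ε → ∀ θ : ℝ, 0 < θ → ∃ C : ℝ, ∀ F : Finset ℂ, (↑F : Set ℂ) ⊆ bandSet Z ε →
        ∑ s ∈ F, (1 + |s.im|) ^ (-θ) ≤ C) → ∀ ε : ℝ, 0 < ε → (bandSet Z ε).Finite := by
  classical
  intro h
  have hrungs : ∀ ε : ℝ, 0 < ε → ∀ θ : ℝ, 0 < θ → ∃ C : ℝ, ∀ F : Finset ℂ,
      (↑F : Set ℂ) ⊆ bandSet (zeroSetFn (Set.range sparsePt)) ε →
        ∑ s ∈ F, (1 + |s.im|) ^ (-θ) ≤ C := by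
    intro ε _ θ hθ
    set r : ℝ := (2 : ℝ) ^ (-θ) with hr
    have hr0 : 0 ≤ r := Real.rpow_nonneg (by norm_num) _
    have hr1 : r < 1 := Real.rpow_lt_one_of_one_lt_of_neg (by norm_num) (by linarith)
    refine ⟨(1 - r)⁻¹, fun F hF => ?_⟩
    obtain ⟨P, -, rfl⟩ := Finset.subset_set_image_iff.1
      (show (↑F : Set ℂ) ⊆ sparsePt '' Set.univ by
        rw [Set.image_univ]; exact hF.trans (bandSet_zeroSetFn_range_sparsePt_subset ε))
    rw [Finset.sum_image fun a _ b _ hab => sparsePt_injective hab]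
    have hterm : ∀ n : ℕ, (1 + |(sparsePt n).im|) ^ (-θ) ≤ r ^ n := by
      intro n
      rw [sparsePt_im, abs_of_pos (by positivity)]
      have h2n : (0 : ℝ) < (2 : ℝ) ^ n := by positivity
      calc (1 + (2 : ℝ) ^ n) ^ (-θ) ≤ ((2 : ℝ) ^ n) ^ (-θ) :=
            Real.rpow_le_rpow_of_nonpos h2n (by linarith) (by linarith)
        _ = r ^ n := by
            rw [hr, ← Real.rpow_natCast, ← Real.rpow_mul (by norm_num), mul_comm,
              Real.rpow_mul (by norm_num), Real.rpow_natCast]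
    calc ∑ n ∈ P, (1 + |(sparsePt n).im|) ^ (-θ) ≤ ∑ n ∈ P, r ^ n :=
          Finset.sum_le_sum fun n _ => hterm n
      _ ≤ ∑' n : ℕ, r ^ n :=
          (summable_geometric_of_lt_one hr0 hr1).sum_le_tsum P fun n _ => by positivity
      _ = (1 - r)⁻¹ := tsum_geometric_of_lt_one hr0 hr1
  have hband := h _ hrungs (1 / 4) (by norm_num)
  refine (Set.infinite_range_of_injective sparsePt_injective) (hband.subset ?_)
  rintro _ ⟨n, rfl⟩
  refine ⟨(zeroSetFn_eq_zero_iff _ _).2 ⟨n, rfl⟩, ?_, ?_, ?_⟩ <;> rw [sparsePt_re] <;>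
    norm_num [abs_of_pos]

/-! ## 5. Tightness: the critical line is the only possible band (Hardy) -/

/-- The band of `ζ` centred at an abscissa `σ₀` instead of `1/2`. [folklore] -/
def bandSetAt (σ₀ ε : ℝ) : Set ℂ :=
  {s : ℂ | riemannZeta s = 0 ∧ 0 < s.re ∧ s.re < 1 ∧ ε ≤ |s.re - σ₀|}

/-- At `σ₀ = 1/2` this is the crux's band. [folklore] -/
theorem bandSetAt_half (ε : ℝ) : bandSetAt (1 / 2) ε = bandSet riemannZeta ε := rfl

/-- TIGHTNESS OF THE LINE (unconditional, Hardy 1914, PROVED in tree as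
`Literature.NumberTheory.LFunctions.hardy_infinite_zeros_on_critical_line_holds`): the crux centred
at any other abscissa `σ₀ ≠ 1/2` is FALSE — the critical zeros form an infinite band at level
`|1/2 − σ₀|`. The accumulation set of `{Re ρ}` CONTAINS `1/2`; the crux says it EQUALS `{1/2}`.
[folklore] -/
theorem not_band_at_other_line {σ₀ : ℝ} (h : σ₀ ≠ 1 / 2) :
    ¬ ∀ ε : ℝ, 0 < ε → (bandSetAt σ₀ ε).Finite := by
  intro hall
  have hpos : 0 < |1 / 2 - σ₀| := abs_pos.2 (sub_ne_zero.2 (Ne.symm h))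
  have hfin := hall _ hpos
  have hH : {t : ℝ | riemannZeta (1 / 2 + t * I) = 0}.Infinite :=
    Literature.NumberTheory.LFunctions.hardy_infinite_zeros_on_critical_line_holds
  have hsub : (fun t : ℝ => (1 : ℂ) / 2 + t * I) '' {t : ℝ | riemannZeta (1 / 2 + t * I) = 0}
      ⊆ bandSetAt σ₀ |1 / 2 - σ₀| := by
    rintro _ ⟨t, ht, rfl⟩
    refine ⟨ht, ?_, ?_, ?_⟩ <;> rw [critPt_re] <;> norm_num
  have hinj : Set.InjOn (fun t : ℝ => (1 : ℂ) / 2 + t * I)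
      {t : ℝ | riemannZeta (1 / 2 + t * I) = 0} := by
    intro a _ b _ hab
    have h' := congrArg Complex.im hab
    simpa only [critPt_im] using h'
  exact (hH.image hinj).mono hsub hfin

end Summit.RiemannHypothesis.RiemannHypothesis.Theorems.AsymptoticCriticalLine.Negative

end
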